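import Summits.NavierStokesRegularity.FluidComputer.SwirlBarrierSpace
import HarnessLib

/-!
# Tools for the swirl-rate barrier `K Ψ_a(|x − c|/ℓ(t))` (the `A = 0` profile at a general scale)

Cell `ns-blowup`, seat `ns-blowup-ecbridge-2` (g13). Proof file (NO definitions, no named facts, no
`sorry`): the `A = 0` specialisations of the barrier calculus of `SwirlBarrierProfile.lean` /
`SwirlBarrierSpace.lean` (profile `G(σ) = K Ψ_a(μ√σ)`, `Ψ_a(s) = (1 − e^{−as})/a`, WITHOUT the
quadratic term), with the Type-I scale `1/√(T − t)` replaced by a general scale `μ = 1/ℓ(t)`: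
σ-derivatives and the Laplacian value (`hasDerivAt_swirlProfileSq`, `hasDerivAt_swirlProfileSq₁`,
`two_mul_swirlProfileSq₁`, `laplacian_value_swirlProfileSq`), smoothness off the centre
(`contDiffAt_swirlProfile_comp`), the time derivative along a differentiable scale `ℓ`
(`hasDerivAt_swirlProfile_scale`), space–time continuity (`continuousOn_swirlProfile_scale`), the
boundary lower bound on the ball `|x − c| ≤ ℓ` (`swirlProfile_scale_lower`) and the closedness of the
graph of the shrinking balls (`isClosed_graph_closedBall`). Consumer: `SwirlRateBarrier.lean`.
WHAT THIS IS NOT: not Navier–Stokes evidence — calculus. [cite: Lieberman1996, Ch. II Lemma 2.1]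
-/

noncomputable section

open MeasureTheory Set Function Filter Topology Metric InnerProductSpace WithLp
open scoped RealInnerProductSpace Laplacian ContDiff NNReal
open Literature.Analysis Literature.Analysis.FluidPDE

namespace Summit.NavierStokesRegularity.FluidComputer

section RateTools

/-- `σ`-derivative of `G(σ) = K Ψ_a(μ√σ)` on `(0, ∞)`: `K e^{−aμ√σ} μ/(2√σ)`. [folklore] -/
theorem hasDerivAt_swirlProfileSq (K : ℝ) {a : ℝ} (μ : ℝ) (ha : a ≠ 0) {σ : ℝ} (hσ : 0 < σ) :
    HasDerivAt (fun σ : ℝ => K * ((1 - Real.exp (-(a * (μ * Real.sqrt σ)))) / a))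
      (K * (Real.exp (-(a * (μ * Real.sqrt σ))) * (μ / (2 * Real.sqrt σ)))) σ := by
  have h := hasDerivAt_swirlBarrierSq K 0 μ ha hσ
  refine (h.congr_of_eventuallyEq (Eventually.of_forall fun y => ?_)).congr_deriv ?_
  · simp only [zero_mul, add_zero]
  · simp only [zero_mul, add_zero]

/-- Second `σ`-derivative: `−(Kμ/4) e^{−aμ√σ} (aμ/σ + 1/(σ√σ))`. [folklore] -/
theorem hasDerivAt_swirlProfileSq₁ (K a μ : ℝ) {σ : ℝ} (hσ : 0 < σ) :
    HasDerivAt (fun σ : ℝ => K * (Real.exp (-(a * (μ * Real.sqrt σ))) * (μ / (2 * Real.sqrt σ))))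
      (-(K * μ / 4) * Real.exp (-(a * (μ * Real.sqrt σ))) * (a * μ / σ + 1 / (σ * Real.sqrt σ)))
      σ := by
  have h := hasDerivAt_swirlBarrierSq₁ K 0 a μ hσ
  refine h.congr_of_eventuallyEq (Eventually.of_forall fun y => ?_)
  simp only [zero_mul, add_zero]

/-- `2 G'(ρ²) = K μ e^{−aμρ}/ρ` for `ρ > 0`. [folklore] -/
theorem two_mul_swirlProfileSq₁ (K a μ : ℝ) {ρ : ℝ} (hρ : 0 < ρ) :
    2 * (K * (Real.exp (-(a * (μ * Real.sqrt (ρ ^ 2)))) * (μ / (2 * Real.sqrt (ρ ^ 2))))) =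
      K * μ * Real.exp (-(a * (μ * ρ))) / ρ := by
  have h := two_mul_swirlBarrierSq₁_sq K 0 a μ hρ
  simp only [mul_zero, zero_mul, add_zero] at h
  exact h

/-- `4 G''(ρ²) ρ² + 6 G'(ρ²) = −K a μ² e^{−aμρ} + 2Kμ e^{−aμρ}/ρ` (`ρ > 0`): the Laplacian of
`x ↦ G(|x − c|²)` at distance `ρ` from `c`. [folklore] -/
theorem laplacian_value_swirlProfileSq (K a μ : ℝ) {ρ : ℝ} (hρ : 0 < ρ) :
    4 * (-(K * μ / 4) * Real.exp (-(a * (μ * Real.sqrt (ρ ^ 2)))) *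
          (a * μ / ρ ^ 2 + 1 / (ρ ^ 2 * Real.sqrt (ρ ^ 2)))) * ρ ^ 2 +
        6 * (K * (Real.exp (-(a * (μ * Real.sqrt (ρ ^ 2)))) * (μ / (2 * Real.sqrt (ρ ^ 2))))) =
      -(K * a * μ ^ 2 * Real.exp (-(a * (μ * ρ)))) + 2 * K * μ * Real.exp (-(a * (μ * ρ))) / ρ := by
  have h := laplacian_value_swirlBarrierSq K 0 a μ hρ
  simp only [mul_zero, zero_mul, add_zero] at h
  exact h

/-- The barrier `x ↦ K Ψ_a(μ|x − c|)` (written through `√(|x − c|²)`) is `C^n` off its centre.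
[folklore] -/
theorem contDiffAt_swirlProfile_comp {K a μ : ℝ} {c x : EuclideanSpace ℝ (Fin 3)} (hx : x ≠ c)
    {n : WithTop ℕ∞} :
    ContDiffAt ℝ n (fun y : EuclideanSpace ℝ (Fin 3) =>
      K * ((1 - Real.exp (-(a * (μ * Real.sqrt (‖y - c‖ ^ 2))))) / a)) x := by
  have h := contDiffAt_swirlBarrier (K := K) (A := 0) (a := a) (μ := μ) hx (n := n)
  simp only [zero_mul, add_zero] at h
  exact h

/-- Time derivative of `t ↦ K Ψ_a(ρ/ℓ(t))` along a differentiable scale `ℓ`: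
`K e^{−aρ/ℓ} ρ (−ℓ')/ℓ²`. [folklore] -/
theorem hasDerivAt_swirlProfile_scale {K a ρ t : ℝ} {ℓ dℓ : ℝ → ℝ} (ha : a ≠ 0)
    (hℓ : HasDerivAt ℓ (dℓ t) t) (hℓ0 : ℓ t ≠ 0) :
    HasDerivAt (fun s : ℝ => K * ((1 - Real.exp (-(a * ((ℓ s)⁻¹ * ρ)))) / a))
      (K * (Real.exp (-(a * ((ℓ t)⁻¹ * ρ))) * (-(dℓ t) / ℓ t ^ 2 * ρ))) t := by
  have h1 : HasDerivAt (fun s : ℝ => (ℓ s)⁻¹ * ρ) (-(dℓ t) / ℓ t ^ 2 * ρ) t :=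
    (hℓ.inv hℓ0).mul_const ρ
  exact ((hasDerivAt_swirlProfile ha ((ℓ t)⁻¹ * ρ)).comp t h1).const_mul K

/-- Space–time continuity of `(t, x) ↦ K Ψ_a(|x − c|/ℓ(t))` on `S × ℝ³` for a continuous
non-vanishing scale `ℓ` on `S`. [folklore] -/
theorem continuousOn_swirlProfile_scale (K a : ℝ) (c : EuclideanSpace ℝ (Fin 3)) {ℓ : ℝ → ℝ}
    {S : Set ℝ} (hℓc : ContinuousOn ℓ S) (hℓ0 : ∀ t ∈ S, ℓ t ≠ 0) :
    ContinuousOn (fun p : ℝ × EuclideanSpace ℝ (Fin 3) =>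
      K * ((1 - Real.exp (-(a * ((ℓ p.1)⁻¹ * Real.sqrt (‖p.2 - c‖ ^ 2))))) / a))
      (S ×ˢ (univ : Set (EuclideanSpace ℝ (Fin 3)))) := by
  have hΨc : Continuous (fun s : ℝ => (1 - Real.exp (-(a * s))) / a) := by fun_prop
  intro p hp
  have hpt : p.1 ∈ S := (mem_prod.1 hp).1
  have hℓinv : ContinuousWithinAt (fun p : ℝ × EuclideanSpace ℝ (Fin 3) => (ℓ p.1)⁻¹)
      (S ×ˢ univ) p :=
    ((hℓc p.1 hpt).comp continuous_fst.continuousWithinAt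
      (fun q hq => (mem_prod.1 hq).1)).inv₀ (hℓ0 p.1 hpt)
  have h5 : ContinuousWithinAt
      (fun p : ℝ × EuclideanSpace ℝ (Fin 3) => Real.sqrt (‖p.2 - c‖ ^ 2)) (S ×ˢ univ) p :=
    (by fun_prop : Continuous fun p : ℝ × EuclideanSpace ℝ (Fin 3) =>
      Real.sqrt (‖p.2 - c‖ ^ 2)).continuousWithinAt
  exact continuousWithinAt_const.mul (hΨc.continuousAt.comp_continuousWithinAt (hℓinv.mul h5))

/-- **Boundary lower bound on the ball `|x − c| ≤ ℓ`**: for `K ≥ 0`, `a > 0`, `ℓ > 0`,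
`0 ≤ ρ ≤ ℓ`: `K e^{−a} (ρ/ℓ) ≤ K Ψ_a(ρ/ℓ)` and `0 ≤ K Ψ_a(ρ/ℓ)` (`s e^{−as} ≤ Ψ_a(s)` at
`s = ρ/ℓ ≤ 1`). [folklore] -/
theorem swirlProfile_scale_lower {K a ℓ ρ : ℝ} (hK : 0 ≤ K) (ha : 0 < a) (hℓ : 0 < ℓ) (hρ0 : 0 ≤ ρ)
    (hρ : ρ ≤ ℓ) :
    K * Real.exp (-a) * (ρ / ℓ) ≤ K * ((1 - Real.exp (-(a * (ρ / ℓ)))) / a) ∧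
      0 ≤ K * ((1 - Real.exp (-(a * (ρ / ℓ)))) / a) := by
  have hs0 : 0 ≤ ρ / ℓ := by positivity
  have hs1 : ρ / ℓ ≤ 1 := (div_le_one hℓ).2 hρ
  refine ⟨?_, mul_nonneg hK (swirlProfile_nonneg ha hs0)⟩
  have h1 := mul_exp_le_swirlProfile ha (ρ / ℓ)
  have h2 : Real.exp (-a) ≤ Real.exp (-(a * (ρ / ℓ))) :=
    Real.exp_le_exp.2 (by nlinarith)
  have h3 : Real.exp (-a) * (ρ / ℓ) ≤ (1 - Real.exp (-(a * (ρ / ℓ)))) / a := by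
    have := mul_le_mul_of_nonneg_left h2 hs0
    nlinarith
  have := mul_le_mul_of_nonneg_left h3 hK
  linarith

/-- The graph `{(t, x) : t ∈ [t₀, T'], |x − c| ≤ ℓ(t)}` of the balls along a continuous scale is
closed. [folklore] -/
theorem isClosed_graph_closedBall {ℓ : ℝ → ℝ} {t₀ T' : ℝ} (hℓc : ContinuousOn ℓ (Icc t₀ T'))
    (c : EuclideanSpace ℝ (Fin 3)) :
    IsClosed {p : ℝ × EuclideanSpace ℝ (Fin 3) | p.1 ∈ Icc t₀ T' ∧ p.2 ∈ closedBall c (ℓ p.1)} := by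
  have hcont : ContinuousOn (fun p : ℝ × EuclideanSpace ℝ (Fin 3) => ‖p.2 - c‖ - ℓ p.1)
      (Icc t₀ T' ×ˢ univ) :=
    (continuous_norm.comp (continuous_snd.sub continuous_const)).continuousOn.sub
      (hℓc.comp continuous_fst.continuousOn fun p hp => (mem_prod.1 hp).1)
  have h := hcont.preimage_isClosed_of_isClosed (isClosed_Icc.prod isClosed_univ) isClosed_Iic
    (t := Iic 0)
  convert h using 1
  ext p
  simp only [mem_setOf_eq, mem_inter_iff, mem_prod, mem_univ, and_true, mem_preimage, mem_Iic,
    mem_closedBall_iff_norm, sub_nonpos]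

end RateTools

end Summit.NavierStokesRegularity.FluidComputer

end
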